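/-
Copyright (c) 2026 the pub-hodgecm-mathlib formalisation cell (harness21).  Prover seat hodgecm-mathlib-LH7-p05 (g2) on the CHAIR K2-lead VALVE,
Track B «K2-LIT» ∕ hLiu418 #184♮ = `stmt-HodgeConjecture-24832`, Road I v3, FACE-G road (E), brick (E-g) «POLYNOMIAL PARTNER» — THE HEAD
(LEAD F0P6-plan (g14) BATCH #180 «LH7-p05 → (E-g) HEAD now»; F4 lead K2Liu-p27 (g2) 23:21:29Z; K2E5-r02 (g6) (F-i) 23:16:26Z).
THEOREMS ONLY (no `def`, no `instance`, no notation, no named-fact hypothesis, no `sorry`); lane `--supports stmt-HodgeConjecture-24832 --as helper`.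
-/
import Summits.HodgeConjecture.HodgeConjecture.Theorems.K2LiuArchSWDegreeTruncation        -- ★ p863184 (E-g-an) FILE 1: `tendsto_degTrunc`, `degTrunc_mem_span_range`
import Summits.HodgeConjecture.HodgeConjecture.Theorems.K2LiuArchSWSectionContinuity       -- ★ p863271 (E-g-an) FILE 2: `exists_clm_swSectionTensor_tmul`
import Summits.HodgeConjecture.HodgeConjecture.Theorems.K2LiuFockFinitePartnerOfClosedRange -- ★ p863009 (E-g) core: `exists_partner_of_tendsto_seq`
import Summits.HodgeConjecture.HodgeConjecture.Theorems.K2LiuFaceGLetterDefs                -- ★ `genFamily`, `IsArchStable` (the letters of record)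
import Literature.NumberTheory.GelbartRogawski1991.DoubledWeilRepresentationArchVacuum         -- ★ `GRConstruction.frameD` (the scaled Folland frame of the doubled space)
import Literature.Analysis.SegalBargmann.SchwartzBargmannIntertwining                         -- ★ `binvPi`, `binvPiₗ`, `binvPi_zeta` (`B⁻¹ ζ_β = h_β`)
import HarnessLib

/-!
# Crux `HLiu418`, FACE-G road (E), brick (E-g): THE POLYNOMIAL PARTNER — every archimedean vector has, for each finite datum `f`, a FOCK-FINITE partner
# with the SAME twisted Siegel–Weil generator family, modulo ONE finiteness letter (the sections of the truncations of `V` span a finite-dimensional space)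

Cell `hodgecm-mathlib`, crux item hLiu418 = `stmt-HodgeConjecture-24832` (helper lane, count-neutral; closes no socket).  Namespace
`Summit.HodgeConjecture.HodgeConjecture.Cruxes.HLiu418.K2LiuArchSWPolynomialPartner`.

THE TARGET = the letter (partner) of ★ p863249 `K2LiuArchSWDataFinalPassage.forall_domain_good_of_archGenerators` at the generating family
`t := follandHermite frameD′` (the Hermite vectors of the BIG doubled frame `frameD′ = frameD(e′, dV, dW ⊗ dV′)`, ★ p862796's frame):
`∀ V (fd) (IsArchStable), ∀ a ∈ V, ∀ f, ∃ w ∈ span (range t), genFamily … (E(w ⊗ f)) = genFamily … (E(a ⊗ f))`.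
ROAD (K2E5-r02 (g6) (F-i) (1)–(4)): `w := lim` of the degree truncations `Tr_N a` (★ FILE 1: `Tr_N a → a`, `Tr_N a ∈ span (range t)`), transported through the CONTINUOUS
LINEAR Siegel–Weil map `T : 𝓢_∞ →L[ℂ] (H(𝔸) → ℂ)`, `T v h = swSectionTensor sB (E(v ⊗ f)) h` (★ FILE 2), landing in a finite-dimensional — hence closed — space
(★ p863009 `exists_partner_of_tendsto_seq`); `genFamily` is the pointwise twist `d(h) · height(h)^{2(s−s₀)} · (section)`, so equal sections give equal families.
THE ONE LETTER BY VALUE (`hfin`, the (E-g-fin) output in section currency): the functions `h ↦ swSectionTensor sB (E(Tr_N v ⊗ f)) h`, `N ∈ ℕ`, `v ∈ V`, span a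
FINITE-DIMENSIONAL subspace of `H(𝔸) → ℂ` — TRUE for `V` finite-dimensional and `K̃_∞`-stable: `Tr_N` intertwines the archimedean compact (★ FILE 1
`degTrunc_carrierConjEquiv_of_proj_eq_realifySp`), so `Tr_N(V)` is a quotient `K̃_∞`-module of `V` and the archimedean factors of its sections are matrix coefficients of
`V` (`dim ≤ (dim V)²`, r02 (4); compact-picture half ★ p863082 `K2LiuArchSWFiniteTypeRange` (K2Liu-p13), second hand K2Liu-p11) — NOT proved here.
* §0 (generic Folland frame) `exists_binvPi_of_mem_span_follandHermite` — Hermite-finite ⇒ `w = e^* B⁻¹ F` (the two readings of «Fock-finite» agree).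
* §1 `genFamily_eq_of_swSectionTensor_eq` — equal Siegel–Weil sections ⇒ equal generator families.
* §2 **`exists_fockFinite_partner_of_finiteRange`** — (partner) for ONE `a`, `f` from `hfin`; `exists_fockFinite_partner_of_sections_mem` — the same with the letter in
  «picture» shape (`U` finite-dimensional ∋ every truncation section); `exists_fockPolynomial_partner_of_finiteRange` — the Fock-polynomial reading `w = frameD′^* B⁻¹ F`
  (★ p863253 `tupleVecOf` currency); **`partner_letter_of_finiteRange`** — the (partner) binder of ★ p863249 VERBATIM (`t := follandHermite frameD′`) from the `∀ V f` form of `hfin`.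
References: [Howe1989, §3]; [Folland1989, §1.7 (1.81), §4.2 Prop. (4.39)]; [Rudin1991, Thm. 1.21]; [KudlaRallis1994, §1 Thm. 1.1, §3]; [Weil1964, Chap. III n° 37–40 pp. 188–191].
HONEST LABEL: HC_CM is proved only modulo the 7 printed citations (2 remaining named inputs: hLiu418 = stmt-HodgeConjecture-24832, h413 = stmt-HodgeConjecture-24833) until
rung 0 closes; count-neutral helper (`--supports stmt-HodgeConjecture-24832 --as helper`), closes no socket, moves no counter.
-/

set_option autoImplicit false
set_option linter.dupNamespace false -- the mandated namespace repeats `HodgeConjecture.HodgeConjecture`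

noncomputable section

open scoped Matrix TensorProduct SchwartzMap Classical
open NumberField NumberField.mixedEmbedding IsDedekindDomain Filter Topology
open Literature.NumberTheory.Automorphic Literature.NumberTheory.Automorphic.UnitaryGroup Literature.NumberTheory.GaloisRepresentations
open Literature.NumberTheory.GelbartRogawski1991 Literature.NumberTheory.GelbartRogawski1991.GRConstruction
open Literature.NumberTheory.Automorphic.Liu2021.Def411WeilCarriersDoubling
open Literature.NumberTheory.Weil1964 Literature.Analysis.SegalBargmann
open Literature.NumberTheory.K2Lit.SiegelDoubled
open Summit.HodgeConjecture.HodgeConjecture.Cruxes.HLiu418.K2LiuFaceGLetterDefs (genFamily IsArchStable)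
open Summit.HodgeConjecture.HodgeConjecture.Cruxes.HLiu418.K2LiuArchSWDegreeTruncation (tendsto_degTrunc degTrunc_mem_span_range)
open Summit.HodgeConjecture.HodgeConjecture.Cruxes.HLiu418.K2LiuArchSWSectionContinuity (exists_clm_swSectionTensor_tmul)
open Summit.HodgeConjecture.HodgeConjecture.Cruxes.HLiu418.K2LiuFockFinitePartnerOfClosedRange (exists_partner_of_tendsto_seq)

namespace Summit.HodgeConjecture.HodgeConjecture.Cruxes.HLiu418.K2LiuArchSWPolynomialPartner

/-! ## §0 Hermite-finite vectors are Fock polynomials (generic Folland frame) -/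

section Generic

variable {σ : Type*} [Fintype σ] [DecidableEq σ] {D : Type*} [NormedAddCommGroup D] [NormedSpace ℝ D] (eF : D ≃L[ℝ] (σ → ℝ))

/-- **Hermite-finite ⇒ Fock polynomial** (the two readings of «Fock-finite» agree): every `w ∈ span (range (follandHermite e))` is `e^* B⁻¹ F` for some polynomial
`F ∈ ℂ[σ]` — `h_β = e^* B⁻¹ ζ_β` (★ `binvPi_zeta`, definitional) and `F ↦ e^* B⁻¹ F` is linear (★ `binvPiₗ`). [cite: Folland1989, §1.7 (1.81)] -/
theorem exists_binvPi_of_mem_span_follandHermite {w : 𝓢(D, ℂ)} (hw : w ∈ Submodule.span ℂ (Set.range (follandHermite eF))) :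
    ∃ F : MvPolynomial σ ℂ, w = (schwartzTransport eF).symm (binvPi F) := by
  have hle : Submodule.span ℂ (Set.range (follandHermite eF)) ≤
      LinearMap.range ((schwartzTransport eF).symm.toLinearEquiv.toLinearMap.comp binvPiₗ) := by
    rw [Submodule.span_le]
    rintro _ ⟨β, rfl⟩
    exact ⟨zeta β, rfl⟩
  obtain ⟨F, hF⟩ := LinearMap.mem_range.1 (hle hw)
  exact ⟨F, hF.symm⟩

end Generic

variable (L : Type) [Field L] [NumberField L] [IsCMField L] {n : ℕ} (e : Fin 2 × Fin 1 ≃ Fin n)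
  (dV : Fin 2 → L) (hdV : ∀ i, IsCMField.complexConj L (dV i) = dV i) (hdV0 : ∀ i, dV i ≠ 0)
  (dW : Fin 1 → L) (hdW : ∀ i, IsCMField.complexConj L (dW i) = dW i) (hdW0 : ∀ i, dW i ≠ 0)
  {M' n' : ℕ} (eW : Fin 1 × Fin 3 ≃ Fin M') (e' : Fin 2 × Fin M' ≃ Fin n')
  (dV' : Fin 3 → L) (hdV' : ∀ k, IsCMField.complexConj L (dV' k) = dV' k) (hdV'0 : ∀ k, dV' k ≠ 0)
  (χb : HeckeCharacter L) (hχbu : χb.IsUnitary) (hχbs : Literature.RepresentationTheory.HarrisKudlaSweet1996.IsSplittingChar L 1 χb)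
  (α : UnitaryGroup.adelicOne (Fp L) L (IsCMField.complexConj L) →* ℂˣ) (𝒦 : IwasawaDatum L e dV hdV dW hdW)

/-! ## §1 Equal sections give equal generator families -/

/-- **equal Siegel–Weil sections ⇒ equal twisted generator families**: `genFamily Φ = (s, h) ↦ d(h) · height(h)^{2(s−s₀)} · f^{V′}_Φ(h)` reads `Φ` only through its section.
[cite: KudlaRallis1994, §1 Thm. 1.1] -/
theorem genFamily_eq_of_swSectionTensor_eq {Φ Ψ : piSchwartzBruhat (Fp L) (Fin (n' + n'))}
    (h : swSectionTensor L e dV hdV dW hdW eW e' dV' hdV' hdV0 hdW0 hdV'0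
        (doubledWeilRep L e' dV hdV hdV0 (tensorFrame L dW eW dV') (tensorFrame_real L dW hdW eW dV' hdV')
          (tensorFrame_ne_zero L dW eW dV' hdW0 hdV'0) χb hχbu hχbs) Φ =
      swSectionTensor L e dV hdV dW hdW eW e' dV' hdV' hdV0 hdW0 hdV'0
        (doubledWeilRep L e' dV hdV hdV0 (tensorFrame L dW eW dV') (tensorFrame_real L dW hdW eW dV' hdV')
          (tensorFrame_ne_zero L dW eW dV' hdW0 hdV'0) χb hχbu hχbs) Ψ) :
    genFamily L e dV hdV hdV0 dW hdW hdW0 eW e' dV' hdV' hdV'0 χb hχbu hχbs α 𝒦 Φ = genFamily L e dV hdV hdV0 dW hdW hdW0 eW e' dV' hdV' hdV'0 χb hχbu hχbs α 𝒦 Ψ := by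
  unfold genFamily
  rw [h]

/-! ## §2 The polynomial partner -/

/-- **THE POLYNOMIAL PARTNER OF ONE ARCHIMEDEAN VECTOR** (brick (E-g), K2E5-r02 (F-i) (1)–(4)).  `V ⊂ 𝓢_∞` any submodule, `a ∈ V`, `f` a finite Schwartz–Bruhat vector;
`Tr_N` the degree truncation of the BIG doubled frame `frameD′` (★ FILE 1, written out).  IF the sections `h ↦ swSectionTensor sB (E(Tr_N v ⊗ f)) h` (`N ∈ ℕ`, `v ∈ V`) span a
finite-dimensional space (`hfin` — the (E-g-fin) letter in section currency; true for `V` finite-dimensional and `K̃_∞`-stable, see the module docstring), THEN some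
FOCK-FINITE `w ∈ span (range (follandHermite frameD′))` has `genFamily (E(w ⊗ f)) = genFamily (E(a ⊗ f))`.  Proof: ★ p863009 `exists_partner_of_tendsto_seq` at ★ FILE 2's
`T` (`P := span (range (follandHermite frameD′))`, `SF := span {Tr_N v}`, `hv hvP` = ★ FILE 1), then §1.
[cite: Howe1989, §3] [cite: Folland1989, §1.7 (1.81)] [cite: Rudin1991, Thm. 1.21] [cite: KudlaRallis1994, §1 Thm. 1.1] -/
theorem exists_fockFinite_partner_of_finiteRange (V : Submodule ℂ 𝓢(((Fin (n' + n')) → mixedSpace (Fp L)), ℂ))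
    {a : 𝓢(((Fin (n' + n')) → mixedSpace (Fp L)), ℂ)} (ha : a ∈ V) (f : FinSB (Fp L) (Fin (n' + n')))
    (hfin : FiniteDimensional ℂ ↥(Submodule.span ℂ {φ : HA L e dV hdV dW hdW → ℂ | ∃ (N : ℕ) (v : 𝓢(((Fin (n' + n')) → mixedSpace (Fp L)), ℂ)), v ∈ V ∧
      φ = fun h => swSectionTensor L e dV hdV dW hdW eW e' dV' hdV' hdV0 hdW0 hdV'0
        (doubledWeilRep L e' dV hdV hdV0 (tensorFrame L dW eW dV') (tensorFrame_real L dW hdW eW dV' hdV')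
          (tensorFrame_ne_zero L dW eW dV' hdW0 hdV'0) χb hχbu hχbs)
        (piSchwartzBruhatEquiv (Fp L) (Fin (n' + n'))
          ((schwartzTransport (frameD L e' dV hdV hdV0 (tensorFrame L dW eW dV') (tensorFrame_real L dW hdW eW dV' hdV')
              (tensorFrame_ne_zero L dW eW dV' hdW0 hdV'0))).symm
            (schwartzTransport (euclE (Fin (n' + n') × {v : InfinitePlace (Fp L) // v.IsReal}))
              (∑ d ∈ Finset.range N, degProjS d
                ((schwartzTransport (euclE (Fin (n' + n') × {v : InfinitePlace (Fp L) // v.IsReal}))).symm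
                  (schwartzTransport (frameD L e' dV hdV hdV0 (tensorFrame L dW eW dV') (tensorFrame_real L dW hdW eW dV' hdV')
                    (tensorFrame_ne_zero L dW eW dV' hdW0 hdV'0)) v)))) ⊗ₜ[ℂ] f)) h})) :
    ∃ w ∈ Submodule.span ℂ (Set.range (follandHermite (frameD L e' dV hdV hdV0 (tensorFrame L dW eW dV') (tensorFrame_real L dW hdW eW dV' hdV')
        (tensorFrame_ne_zero L dW eW dV' hdW0 hdV'0)))),
      genFamily L e dV hdV hdV0 dW hdW hdW0 eW e' dV' hdV' hdV'0 χb hχbu hχbs α 𝒦 (piSchwartzBruhatEquiv (Fp L) (Fin (n' + n')) (w ⊗ₜ[ℂ] f)) =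
        genFamily L e dV hdV hdV0 dW hdW hdW0 eW e' dV' hdV' hdV'0 χb hχbu hχbs α 𝒦 (piSchwartzBruhatEquiv (Fp L) (Fin (n' + n')) (a ⊗ₜ[ℂ] f)) := by
  -- ★ FILE 2: the Siegel–Weil map as a CLM
  obtain ⟨T, hT⟩ := exists_clm_swSectionTensor_tmul L e dV hdV hdV0 dW hdW hdW0 eW e' dV' hdV' hdV'0 hχbu hχbs
    (isDoubledWeilRep_doubledWeilRep L e' dV hdV hdV0 (tensorFrame L dW eW dV') (tensorFrame_real L dW hdW eW dV' hdV')
      (tensorFrame_ne_zero L dW eW dV' hdW0 hdV'0) χb hχbu hχbs) f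
  have hTfun : ∀ v : 𝓢(((Fin (n' + n')) → mixedSpace (Fp L)), ℂ), (T : _ →ₗ[ℂ] (HA L e dV hdV dW hdW → ℂ)) v =
      fun h => swSectionTensor L e dV hdV dW hdW eW e' dV' hdV' hdV0 hdW0 hdV'0
        (doubledWeilRep L e' dV hdV hdV0 (tensorFrame L dW eW dV') (tensorFrame_real L dW hdW eW dV' hdV')
          (tensorFrame_ne_zero L dW eW dV' hdW0 hdV'0) χb hχbu hχbs)
        (piSchwartzBruhatEquiv (Fp L) (Fin (n' + n')) (v ⊗ₜ[ℂ] f)) h := fun v => funext fun h => hT v h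
  -- the truncation space `SF := span {Tr_N v : N, v ∈ V}`; its image under `T` sits inside `hfin`'s space
  obtain ⟨w, hwP, -, hTw⟩ := exists_partner_of_tendsto_seq T
    (Submodule.span ℂ (Set.range (follandHermite (frameD L e' dV hdV hdV0 (tensorFrame L dW eW dV') (tensorFrame_real L dW hdW eW dV' hdV')
      (tensorFrame_ne_zero L dW eW dV' hdW0 hdV'0)))))
    (Submodule.span ℂ {x : 𝓢(((Fin (n' + n')) → mixedSpace (Fp L)), ℂ) | ∃ (N : ℕ) (v : 𝓢(((Fin (n' + n')) → mixedSpace (Fp L)), ℂ)), v ∈ V ∧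
      x = (schwartzTransport (frameD L e' dV hdV hdV0 (tensorFrame L dW eW dV') (tensorFrame_real L dW hdW eW dV' hdV')
              (tensorFrame_ne_zero L dW eW dV' hdW0 hdV'0))).symm
            (schwartzTransport (euclE (Fin (n' + n') × {v : InfinitePlace (Fp L) // v.IsReal}))
              (∑ d ∈ Finset.range N, degProjS d
                ((schwartzTransport (euclE (Fin (n' + n') × {v : InfinitePlace (Fp L) // v.IsReal}))).symm
                  (schwartzTransport (frameD L e' dV hdV hdV0 (tensorFrame L dW eW dV') (tensorFrame_real L dW hdW eW dV' hdV')
                    (tensorFrame_ne_zero L dW eW dV' hdW0 hdV'0)) v))))})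
    (by
      refine @Submodule.finiteDimensional_of_le ℂ _ _ _ _ _ _ hfin ?_
      rw [Submodule.map_span_le]
      rintro _ ⟨N, v, hv, rfl⟩
      exact Submodule.subset_span ⟨N, v, hv, hTfun _⟩)
    (tendsto_degTrunc _ a) (fun N => degTrunc_mem_span_range _ a N) (fun N => Submodule.subset_span ⟨N, a, ha, rfl⟩)
  refine ⟨w, hwP, genFamily_eq_of_swSectionTensor_eq L e dV hdV hdV0 dW hdW hdW0 eW e' dV' hdV' hdV'0 χb hχbu hχbs α 𝒦 ?_⟩
  funext h
  exact (hT w h).symm.trans ((congrFun hTw h).trans (hT a h))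

/-- **THE SAME, WITH THE FINITENESS LETTER IN «PICTURE» SHAPE** (★ p863082 (E-g-fin) currency: a FIXED finite-dimensional space `U` of functions on `H(𝔸)` containing the
section of every truncation `Tr_N v`, `v ∈ V` — e.g. `U :=` the lawful sections with compact picture in a finite-dimensional space of carriers).
[cite: Howe1989, §3] [cite: KudlaRallis1994, §1 Thm. 1.1] [cite: Knapp1986, Ch. VII §1] -/
theorem exists_fockFinite_partner_of_sections_mem (V : Submodule ℂ 𝓢(((Fin (n' + n')) → mixedSpace (Fp L)), ℂ))
    {a : 𝓢(((Fin (n' + n')) → mixedSpace (Fp L)), ℂ)} (ha : a ∈ V) (f : FinSB (Fp L) (Fin (n' + n')))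
    (U : Submodule ℂ (HA L e dV hdV dW hdW → ℂ)) [FiniteDimensional ℂ U]
    (hU : ∀ (N : ℕ), ∀ v ∈ V, (fun h => swSectionTensor L e dV hdV dW hdW eW e' dV' hdV' hdV0 hdW0 hdV'0
        (doubledWeilRep L e' dV hdV hdV0 (tensorFrame L dW eW dV') (tensorFrame_real L dW hdW eW dV' hdV')
          (tensorFrame_ne_zero L dW eW dV' hdW0 hdV'0) χb hχbu hχbs)
        (piSchwartzBruhatEquiv (Fp L) (Fin (n' + n'))
          ((schwartzTransport (frameD L e' dV hdV hdV0 (tensorFrame L dW eW dV') (tensorFrame_real L dW hdW eW dV' hdV')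
              (tensorFrame_ne_zero L dW eW dV' hdW0 hdV'0))).symm
            (schwartzTransport (euclE (Fin (n' + n') × {v : InfinitePlace (Fp L) // v.IsReal}))
              (∑ d ∈ Finset.range N, degProjS d
                ((schwartzTransport (euclE (Fin (n' + n') × {v : InfinitePlace (Fp L) // v.IsReal}))).symm
                  (schwartzTransport (frameD L e' dV hdV hdV0 (tensorFrame L dW eW dV') (tensorFrame_real L dW hdW eW dV' hdV')
                    (tensorFrame_ne_zero L dW eW dV' hdW0 hdV'0)) v)))) ⊗ₜ[ℂ] f)) h) ∈ U) :
    ∃ w ∈ Submodule.span ℂ (Set.range (follandHermite (frameD L e' dV hdV hdV0 (tensorFrame L dW eW dV') (tensorFrame_real L dW hdW eW dV' hdV')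
        (tensorFrame_ne_zero L dW eW dV' hdW0 hdV'0)))),
      genFamily L e dV hdV hdV0 dW hdW hdW0 eW e' dV' hdV' hdV'0 χb hχbu hχbs α 𝒦 (piSchwartzBruhatEquiv (Fp L) (Fin (n' + n')) (w ⊗ₜ[ℂ] f)) =
        genFamily L e dV hdV hdV0 dW hdW hdW0 eW e' dV' hdV' hdV'0 χb hχbu hχbs α 𝒦 (piSchwartzBruhatEquiv (Fp L) (Fin (n' + n')) (a ⊗ₜ[ℂ] f)) :=
  exists_fockFinite_partner_of_finiteRange L e dV hdV hdV0 dW hdW hdW0 eW e' dV' hdV' hdV'0 χb hχbu hχbs α 𝒦 V ha f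
    (Submodule.finiteDimensional_of_le (Submodule.span_le.2 (by
      rintro _ ⟨N, v, hv, rfl⟩
      exact hU N v hv)))

/-- **THE POLYNOMIAL PARTNER, FOCK-POLYNOMIAL READING** (the currency of ★ p863253 `K2LiuArchSWDataTuplesDefs.tupleVecOf` ∕ the (E-g-glue) file: `w = frameD′^* B⁻¹ F`,
`F ∈ ℂ[Fin (n′+n′) × (real places)]`), from §2 and §0. [cite: Folland1989, §1.7 (1.81)] [cite: Howe1989, §3] [cite: KudlaRallis1994, §1 Thm. 1.1] -/
theorem exists_fockPolynomial_partner_of_finiteRange (V : Submodule ℂ 𝓢(((Fin (n' + n')) → mixedSpace (Fp L)), ℂ))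
    {a : 𝓢(((Fin (n' + n')) → mixedSpace (Fp L)), ℂ)} (ha : a ∈ V) (f : FinSB (Fp L) (Fin (n' + n')))
    (hfin : FiniteDimensional ℂ ↥(Submodule.span ℂ {φ : HA L e dV hdV dW hdW → ℂ | ∃ (N : ℕ) (v : 𝓢(((Fin (n' + n')) → mixedSpace (Fp L)), ℂ)), v ∈ V ∧
      φ = fun h => swSectionTensor L e dV hdV dW hdW eW e' dV' hdV' hdV0 hdW0 hdV'0
        (doubledWeilRep L e' dV hdV hdV0 (tensorFrame L dW eW dV') (tensorFrame_real L dW hdW eW dV' hdV')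
          (tensorFrame_ne_zero L dW eW dV' hdW0 hdV'0) χb hχbu hχbs)
        (piSchwartzBruhatEquiv (Fp L) (Fin (n' + n'))
          ((schwartzTransport (frameD L e' dV hdV hdV0 (tensorFrame L dW eW dV') (tensorFrame_real L dW hdW eW dV' hdV')
              (tensorFrame_ne_zero L dW eW dV' hdW0 hdV'0))).symm
            (schwartzTransport (euclE (Fin (n' + n') × {v : InfinitePlace (Fp L) // v.IsReal}))
              (∑ d ∈ Finset.range N, degProjS d
                ((schwartzTransport (euclE (Fin (n' + n') × {v : InfinitePlace (Fp L) // v.IsReal}))).symm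
                  (schwartzTransport (frameD L e' dV hdV hdV0 (tensorFrame L dW eW dV') (tensorFrame_real L dW hdW eW dV' hdV')
                    (tensorFrame_ne_zero L dW eW dV' hdW0 hdV'0)) v)))) ⊗ₜ[ℂ] f)) h})) :
    ∃ F : MvPolynomial (Fin (n' + n') × {v : InfinitePlace (Fp L) // v.IsReal}) ℂ,
      genFamily L e dV hdV hdV0 dW hdW hdW0 eW e' dV' hdV' hdV'0 χb hχbu hχbs α 𝒦 (piSchwartzBruhatEquiv (Fp L) (Fin (n' + n'))
          ((schwartzTransport (frameD L e' dV hdV hdV0 (tensorFrame L dW eW dV') (tensorFrame_real L dW hdW eW dV' hdV')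
        (tensorFrame_ne_zero L dW eW dV' hdW0 hdV'0))).symm (binvPi F) ⊗ₜ[ℂ] f)) =
        genFamily L e dV hdV hdV0 dW hdW hdW0 eW e' dV' hdV' hdV'0 χb hχbu hχbs α 𝒦 (piSchwartzBruhatEquiv (Fp L) (Fin (n' + n')) (a ⊗ₜ[ℂ] f)) := by
  obtain ⟨w, hw, hgen⟩ := exists_fockFinite_partner_of_finiteRange L e dV hdV hdV0 dW hdW hdW0 eW e' dV' hdV' hdV'0 χb hχbu hχbs α 𝒦 V ha f hfin
  obtain ⟨F, hF⟩ := exists_binvPi_of_mem_span_follandHermite _ hw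
  exact ⟨F, (congrArg (fun x : 𝓢(((Fin (n' + n')) → mixedSpace (Fp L)), ℂ) =>
    genFamily L e dV hdV hdV0 dW hdW hdW0 eW e' dV' hdV' hdV'0 χb hχbu hχbs α 𝒦 (piSchwartzBruhatEquiv (Fp L) (Fin (n' + n')) (x ⊗ₜ[ℂ] f)) =
      genFamily L e dV hdV hdV0 dW hdW hdW0 eW e' dV' hdV' hdV'0 χb hχbu hχbs α 𝒦 (piSchwartzBruhatEquiv (Fp L) (Fin (n' + n')) (a ⊗ₜ[ℂ] f))) hF).mp hgen⟩

/-- **THE (partner) LETTER OF ★ `K2LiuArchSWDataFinalPassage.forall_domain_good_of_archGenerators` AT `t := follandHermite frameD′`, BYTES VERBATIM, FROM THE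
FINITENESS LETTER `hfin`** (stated for every finite-dimensional `K̃_∞`-stable `V`). [cite: Howe1989, §3] [cite: Folland1989, §4.2 Prop. (4.39)] [cite: KudlaRallis1994, §3] -/
theorem partner_letter_of_finiteRange
    (hfin : ∀ (V : Submodule ℂ 𝓢(((Fin (n' + n')) → mixedSpace (Fp L)), ℂ)), FiniteDimensional ℂ V →
      IsArchStable L e dV hdV hdV0 dW hdW hdW0 eW e' dV' hdV' hdV'0 χb hχbu hχbs 𝒦 V → ∀ f : FinSB (Fp L) (Fin (n' + n')),
      FiniteDimensional ℂ ↥(Submodule.span ℂ {φ : HA L e dV hdV dW hdW → ℂ | ∃ (N : ℕ) (v : 𝓢(((Fin (n' + n')) → mixedSpace (Fp L)), ℂ)), v ∈ V ∧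
      φ = fun h => swSectionTensor L e dV hdV dW hdW eW e' dV' hdV' hdV0 hdW0 hdV'0
        (doubledWeilRep L e' dV hdV hdV0 (tensorFrame L dW eW dV') (tensorFrame_real L dW hdW eW dV' hdV')
          (tensorFrame_ne_zero L dW eW dV' hdW0 hdV'0) χb hχbu hχbs)
        (piSchwartzBruhatEquiv (Fp L) (Fin (n' + n'))
          ((schwartzTransport (frameD L e' dV hdV hdV0 (tensorFrame L dW eW dV') (tensorFrame_real L dW hdW eW dV' hdV')
              (tensorFrame_ne_zero L dW eW dV' hdW0 hdV'0))).symm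
            (schwartzTransport (euclE (Fin (n' + n') × {v : InfinitePlace (Fp L) // v.IsReal}))
              (∑ d ∈ Finset.range N, degProjS d
                ((schwartzTransport (euclE (Fin (n' + n') × {v : InfinitePlace (Fp L) // v.IsReal}))).symm
                  (schwartzTransport (frameD L e' dV hdV hdV0 (tensorFrame L dW eW dV') (tensorFrame_real L dW hdW eW dV' hdV')
                    (tensorFrame_ne_zero L dW eW dV' hdW0 hdV'0)) v)))) ⊗ₜ[ℂ] f)) h})) :
    ∀ (V : Submodule ℂ 𝓢(((Fin (n' + n')) → mixedSpace (Fp L)), ℂ)), FiniteDimensional ℂ V →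
      IsArchStable L e dV hdV hdV0 dW hdW hdW0 eW e' dV' hdV' hdV'0 χb hχbu hχbs 𝒦 V →
      ∀ a ∈ V, ∀ f : FinSB (Fp L) (Fin (n' + n')), ∃ w ∈ Submodule.span ℂ (Set.range (follandHermite
        (frameD L e' dV hdV hdV0 (tensorFrame L dW eW dV') (tensorFrame_real L dW hdW eW dV' hdV') (tensorFrame_ne_zero L dW eW dV' hdW0 hdV'0)))),
        genFamily L e dV hdV hdV0 dW hdW hdW0 eW e' dV' hdV' hdV'0 χb hχbu hχbs α 𝒦 (piSchwartzBruhatEquiv (Fp L) (Fin (n' + n')) (w ⊗ₜ[ℂ] f)) =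
          genFamily L e dV hdV hdV0 dW hdW hdW0 eW e' dV' hdV' hdV'0 χb hχbu hχbs α 𝒦 (piSchwartzBruhatEquiv (Fp L) (Fin (n' + n')) (a ⊗ₜ[ℂ] f)) :=
  fun V hV hst _ ha f =>
    exists_fockFinite_partner_of_finiteRange L e dV hdV hdV0 dW hdW hdW0 eW e' dV' hdV' hdV'0 χb hχbu hχbs α 𝒦 V ha f (hfin V hV hst f)

end Summit.HodgeConjecture.HodgeConjecture.Cruxes.HLiu418.K2LiuArchSWPolynomialPartner

end
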